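import Summits.CriticalPhenomena.PercolationContinuityZ3.Theorems.PercNearOneGluingNoHeavyQuantFarSunCertElevenFive
import HarnessLib

/-!
# FAR beyond trees: **`HairyCycle.SunFAR 11 5`** — an exact WINDOW-TYPED reached-set-level two-copy certificate for the sun graph with `K = 11` hairs at layer `j = 5` (shared-products Kronecker check, sharded) — shard file 3/4 (`l ∈ {9,10}`)

builds on p205010 (kernel theorem, internal audit signed; external expert review pending)

Support file (`--supports stmt-CriticalPhenomena-4575`), seat `prim-cert-1` (gen 33; certificate from gen 30 kit LPs; pipeline gen 26/28/30/32); memos `prim-cert-1/FROM-prim-cert-1-g26-CONFIG-CERTS.md`, `prim-cert-1/FROM-prim-cert-1-g28-TOP-LAYERS.md`.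
Shard 3 of 4 of the Kronecker check of the `(11,5)` certificate (`PercNearOneGluingNoHeavyQuantFarSunCertElevenFive`): prefix lengths `l ∈ {9, 10}`
(1638 blocks; each shard file stays under the farm's elaboration budget).  COMPUTATIONAL (`native_decide`).
[cite: KozmaNitzan2024, Lemma 2 (p. 6), Conjecture 3 (p. 15)] (context: the lower-tail family; FAR is this programme's statement).
-/

namespace Summit.CriticalPhenomena.PercolationContinuityZ3.Theorems.HairyCycle

namespace TK


/-- Core-inequality check of the `(11, 5)` certificate, shard `l ∈ {9, 10}` (1638 blocks), base `2^29` (computational;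
one `native_decide`, so the record banks are built once). [this work] -/
theorem cK115_s3 : ([9, 10].all fun l => kronL2 11 29 (mkSBanks 11 5 29 (mkNTabs 11 am115 bm115)) l) = true := by
  native_decide

end TK

end Summit.CriticalPhenomena.PercolationContinuityZ3.Theorems.HairyCycle
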